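import Summits.NavierStokesRegularity.NavierStokesRegularity.Theses.LerayQuarterDissipation
import Summits.NavierStokesRegularity.NavierStokesRegularity.Theorems.LerayQuarterDissipationRecurrentDissipativeLiouvilleCriticalRecurrent
import Summits.NavierStokesRegularity.NavierStokesRegularity.Theorems.LerayQuarterDissipationFiniteDissipationLiouvilleEnvelope
import Summits.NavierStokesRegularity.NavierStokesRegularity.Theorems.FiniteDissipationLiouville.Negative.DissLawScaleInvariant
import Summits.NavierStokesRegularity.NavierStokesRegularity.Theorems.LerayQuarterDissipationFiniteDissipationLiouvilleLyapunovTools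
import Summits.NavierStokesRegularity.NavierStokesRegularity.Theorems.LerayQuarterDissipationFiniteDissipationLiouvillePersistenceSeq
import HarnessLib

/-!
# Crux `FiniteDissipationLiouville` (stmt-NavierStokesRegularity-22144), line `birth`:
# the LYAPUNOV REDUCTION — a scale-monotone functional settles the WHOLE crux

Theorems file of route `LerayQuarterDissipation` (lead ns-lqd-lead g7), `--supports 22144`.
Navier–Stokes regularity is NOT proved by anything here; no summit is.

The crux (FDL) is the Liouville problem for Type-I ancient mild fields in the KNSS gauge with
Leray's quarter-rate dissipation law; by `…EnvelopeIff` (p613275) it is the envelope-class Type-I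
ancient Liouville problem, FRONTIER by the census of six lead generations and the critics of record
(2026-08-28): "what would bite is (A) a Lyapunov functional for Leray's similarity flow …"
(Pineau–Vicol 2026, p. 8: excluding backward DSS profiles is a no-shrinking-breathers theorem and
needs a monotone quantity). This file makes target (A) LITERAL AND SHARP for the whole residue —
the wandering (non-DSS) stratum included — using that uniform scaling-RECURRENCE has already been
extracted from any counterexample (ns-lqd-p1's recurrent critical element,
`CriticalElement.exists_recurrent_criticalElement`, Birkhoff in the compact hull).

THE SCALING FLOW. `σ ↦ W_σ := nsRescale (e^σ) W`, `W_σ(s,y) = e^σ W(e^{2σ}s, e^σ y)`, acts on the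
class `𝒮(C,A,K)` of fields that are Type-I ancient mild with constant `C`, carry the space-time
envelope `HasTypeIDecay A`, obey the law with constant `K`, are SINGULAR at the apex and UNIFORMLY
RECURRENT (every clause is scale invariant: `IsTypeIAncientMild.nsRescale`,
`HasTypeIDecay.nsRescale`, `Negative.dissLaw_nsRescale`, `Negative.singularAtApex_nsRescale`,
and `recurrent_nsRescale` below).

A LYAPUNOV FUNCTIONAL for `𝒮(C,A,K)` is ANY real function `F` of fields such that, for members
`V ∈ 𝒮(C,A,K)`:
* (antitone) `σ ↦ F(V_σ)` is non-increasing;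
* (lower semicontinuous along recurrence) if `σ_n → +∞`, `V_{σ_n} → V` uniformly on every
  window `[−R², −R⁻²] × B̄(0,R)` (the convergence of the recurrence clause) AND the spatial
  gradients `∇V_{σ_n} → ∇V` pointwise on the open past, then `F V ≤ liminf F(V_{σ_n})` (in
  `ε`–`N` form) — the gradient clause is free inside the Type-I class (KNSS compactness,
  `Compactness.seqLimit`), so functionals of `V` and `∇V` are admissible;
* (rigid) `σ ↦ F(V_σ)` constant forces `V` regular at the apex.
No strictness over periods, no continuity, no sign and no coercivity are asked.

RESULTS.
* (`…LyapunovTools`) `const_of_antitone_of_recurrence` — the real-variable core: an antitone `f : ℝ → ℝ` with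
  `f σ₀ − δ ≤ f σ` for arbitrarily large `σ` (every `σ₀`, every `δ > 0`) is constant.
* (`…LyapunovTools`) `recurrent_nsRescale`, `exists_seq_of_recurrent` — the recurrence clause is invariant under the
  flow and yields `σ_n → +∞` with `V_{σ_n} → V` on all windows.
* (`…LyapunovTools`) `lyapunov_constant`, and here `lyapunov_constant_fderiv` — along a uniformly
  recurrent member every Lyapunov functional is CONSTANT on the whole orbit (LaSalle's invariance
  principle on a minimal set, in the kernel's clauses; the `_fderiv` form passes to a KNSS
  subsequence carrying the gradients).
* `not_singular_of_lyapunov` — if `𝒮(C,A,K)` admits a Lyapunov functional for every `A`, then no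
  member of `𝒟_{C,K}` is singular; `fdl_of_lyapunov` — **if every `𝒮(C,A,K)` admits a Lyapunov
  functional, the crux `FiniteDissipationLiouville` holds** (by name);
  `fdl_iff_exists_lyapunov` — and conversely (vacuously), so the crux IS the existence of such
  functionals: an exact restatement of the frontier as a variational target;
  `fdl_iff_recurrentEnvelopeClass_empty` — the crux is the emptiness of all `𝒮(C,A,K)`.

WHY THIS IS THE RIGHT SHAPE (census): Tsai's 1998 argument is the case `F` = a maximum principle
quantity for SELF-SIMILAR fields only; Chae–Wolf 2017 / Pineau–Vicol 2026 near `λ = 1` are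
perturbative; the period energy / weighted energy / Gaussian energy identities of leads g3–g6 are
CONSERVED along periods (antitone with equality), hence give no rigidity. A functional with the
three properties above is not known (honest residue unchanged; Bradshaw–Tsai 2017 OP 5.1 inside).
Presearch: "Lyapunov function constant on ω-limit / minimal sets" is LaSalle 1960 / Furstenberg
1981 Ch. 1 folklore; no Navier–Stokes instance in print (queries recorded in the seat's NOTES).
No definitions; standard axioms.
-/

noncomputable section

-- the summit and its single sub-problem share the name (CONVENTIONS §1), as in every Theorems file
set_option linter.dupNamespace false

namespace Summit.NavierStokesRegularity.NavierStokesRegularity.Theorems.FiniteDissipationLiouville.Lyapunov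

open MeasureTheory Set Filter Topology Metric Function
open Literature.Analysis Literature.Analysis.FluidPDE
open Summit.NavierStokesRegularity.NavierStokesRegularity.Theorems.FiniteDissipationLiouville
open scoped ENNReal NNReal

/-! ### Recurrence sequences carry the gradients (KNSS compactness) -/

/-- Window closeness gives pointwise convergence on the open past. -/
theorem tendsto_of_windows {V : ℝ → EuclideanSpace ℝ (Fin 3) → EuclideanSpace ℝ (Fin 3)}
    {l : ℕ → ℝ}
    (hclose : ∀ ε > 0, ∀ R > 1, ∀ᶠ n in atTop,
      ∀ s ∈ Set.Icc (-(R ^ 2)) (-(R⁻¹) ^ 2),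
      ∀ y ∈ Metric.closedBall (0 : EuclideanSpace ℝ (Fin 3)) R,
        ‖Real.exp (l n) • V (Real.exp (2 * l n) * s) (Real.exp (l n) • y) - V s y‖ ≤ ε) :
    ∀ t < 0, ∀ x, Tendsto (fun n => nsRescale (Real.exp (l n)) V t x) atTop (𝓝 (V t x)) := by
  intro t ht x
  -- a window containing `(t, x)`
  set R : ℝ := 2 + ‖x‖ + (-t) + (-t)⁻¹ with hRdef
  have ht0 : 0 < -t := neg_pos.2 ht
  have hR1 : 1 < R := by
    rw [hRdef]; have := norm_nonneg x; have := inv_pos.2 ht0; linarith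
  have hR0 : 0 < R := one_pos.trans hR1
  have hRt : -t ≤ R := by rw [hRdef]; have := norm_nonneg x; have := inv_pos.2 ht0; linarith
  have hRti : (-t)⁻¹ ≤ R := by rw [hRdef]; have := norm_nonneg x; linarith
  have hs : t ∈ Set.Icc (-(R ^ 2)) (-(R⁻¹) ^ 2) := by
    constructor
    · nlinarith
    · have h1 : R⁻¹ ≤ -t := by
        rw [inv_le_comm₀ hR0 ht0]; exact hRti
      have h2 : R⁻¹ ^ 2 ≤ R⁻¹ := by
        have : R⁻¹ ≤ 1 := inv_le_one_of_one_le₀ hR1.le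
        have : 0 ≤ R⁻¹ := inv_nonneg.2 hR0.le
        nlinarith
      linarith
  have hy : x ∈ Metric.closedBall (0 : EuclideanSpace ℝ (Fin 3)) R := by
    rw [mem_closedBall, dist_zero_right, hRdef]; have := inv_pos.2 ht0; linarith
  rw [Metric.tendsto_nhds]
  intro ε hε
  filter_upwards [hclose (ε / 2) (half_pos hε) R hR1] with n hn
  rw [dist_eq_norm, ← exp_smul_eq_nsRescale]
  exact (hn t hs x hy).trans_lt (half_lt_self hε)

/-- **LaSalle on the hull, with gradients.** As `…LyapunovTools.lyapunov_constant`, but the lower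
semicontinuity of `F` is only asked along recurrence sequences along which, IN ADDITION, the spatial
gradients converge pointwise on the open past — which costs nothing inside the Type-I class: by
KNSS compactness (`Compactness.seqLimit`, ns-lqd-p2) every recurrence sequence has such a
subsequence. So functionals of the velocity AND its gradient (local energies, enstrophies,
dissipations) are admissible with the obvious continuity. -/
theorem lyapunov_constant_fderiv {C : ℝ}
    (P : (ℝ → EuclideanSpace ℝ (Fin 3) → EuclideanSpace ℝ (Fin 3)) → Prop)
    (hPmild : ∀ V, P V → IsTypeIAncientMild C V)
    (hP : ∀ V, P V → ∀ c : ℝ, 0 < c → P (nsRescale c V))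
    (hPrec : ∀ V, P V → ∀ ε > 0, ∀ R > 1, ∃ L > 0, ∀ a : ℝ, ∃ σ ∈ Set.Icc a (a + L),
      ∀ s ∈ Set.Icc (-(R ^ 2)) (-(R⁻¹) ^ 2),
      ∀ y ∈ Metric.closedBall (0 : EuclideanSpace ℝ (Fin 3)) R,
        ‖Real.exp σ • V (Real.exp (2 * σ) * s) (Real.exp σ • y) - V s y‖ ≤ ε)
    (F : (ℝ → EuclideanSpace ℝ (Fin 3) → EuclideanSpace ℝ (Fin 3)) → ℝ)
    (hmono : ∀ V, P V → ∀ σ τ : ℝ, σ ≤ τ →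
      F (nsRescale (Real.exp τ) V) ≤ F (nsRescale (Real.exp σ) V))
    (hlsc : ∀ V, P V → ∀ l : ℕ → ℝ, Tendsto l atTop atTop →
      (∀ ε > 0, ∀ R > 1, ∀ᶠ n in atTop,
        ∀ s ∈ Set.Icc (-(R ^ 2)) (-(R⁻¹) ^ 2),
        ∀ y ∈ Metric.closedBall (0 : EuclideanSpace ℝ (Fin 3)) R,
          ‖Real.exp (l n) • V (Real.exp (2 * l n) * s) (Real.exp (l n) • y) - V s y‖ ≤ ε) →
      (∀ t < 0, ∀ x, Tendsto (fun n => fderiv ℝ (nsRescale (Real.exp (l n)) V t) x) atTop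
        (𝓝 (fderiv ℝ (V t) x))) →
      ∀ δ > 0, ∀ᶠ n in atTop, F V - δ ≤ F (nsRescale (Real.exp (l n)) V))
    {W : ℝ → EuclideanSpace ℝ (Fin 3) → EuclideanSpace ℝ (Fin 3)} (hW : P W) :
    ∀ σ : ℝ, F (nsRescale (Real.exp σ) W) = F W := by
  have hconst := const_of_antitone_of_recurrence (f := fun σ => F (nsRescale (Real.exp σ) W))
    (fun σ τ hστ => hmono W hW σ τ hστ) ?_
  · intro σ
    have h := hconst σ 0
    rwa [nsRescale_exp_zero] at h
  intro σ₀ δ hδ B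
  -- the translate `V = W_{σ₀}`, its recurrence sequence, and a KNSS subsequence with gradients
  set V := nsRescale (Real.exp σ₀) W with hVdef
  have hV : P V := hP W hW _ (Real.exp_pos σ₀)
  obtain ⟨l, hl, hclose⟩ := exists_seq_of_recurrent (hPrec _ hV)
  obtain ⟨ψ, hψ, W', -, -, hpt, hgrad⟩ :=
    Compactness.seqLimit (w := fun n => nsRescale (Real.exp (l n)) V)
      (fun n => (hPmild V hV).nsRescale (Real.exp_pos _))
  have hψt : Tendsto ψ atTop atTop := hψ.tendsto_atTop
  -- the subsequential limit is `V` itself (the full sequence converges to `V` pointwise)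
  have hW'V : ∀ t < 0, W' t = V t := by
    intro t ht
    funext x
    exact tendsto_nhds_unique (hpt t ht x) ((tendsto_of_windows hclose t ht x).comp hψt)
  have hclose' : ∀ ε > 0, ∀ R > 1, ∀ᶠ n in atTop,
      ∀ s ∈ Set.Icc (-(R ^ 2)) (-(R⁻¹) ^ 2),
      ∀ y ∈ Metric.closedBall (0 : EuclideanSpace ℝ (Fin 3)) R,
        ‖Real.exp (l (ψ n)) • V (Real.exp (2 * l (ψ n)) * s) (Real.exp (l (ψ n)) • y) - V s y‖ ≤ ε :=
    fun ε hε R hR => hψt.eventually (hclose ε hε R hR)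
  have hgrad' : ∀ t < 0, ∀ x, Tendsto (fun n => fderiv ℝ (nsRescale (Real.exp (l (ψ n))) V t) x)
      atTop (𝓝 (fderiv ℝ (V t) x)) := by
    intro t ht x
    rw [← hW'V t ht]
    exact hgrad t ht x
  have h1 := hlsc V hV (fun n => l (ψ n)) (hl.comp hψt) hclose' hgrad' δ hδ
  have h2 : ∀ᶠ n in atTop, B - σ₀ ≤ l (ψ n) :=
    (hl.comp hψt).eventually (eventually_ge_atTop (B - σ₀))
  obtain ⟨n, hn1, hn2⟩ := (h1.and h2).exists
  refine ⟨σ₀ + l (ψ n), by linarith, ?_⟩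
  simpa only [hVdef, nsRescale_exp_add] using hn1

/-! ### The Lyapunov reduction -/

/-- **THE LYAPUNOV REDUCTION (pointwise in `C, K`).** Suppose that for every envelope constant `A`
there is a real function `F` of fields which, on the class `𝒮(C,A,K)` of Type-I ancient mild fields
(KNSS gauge, constant `C`) with the envelope `HasTypeIDecay A`, the dissipation law with constant
`K`, SINGULAR at the apex and UNIFORMLY RECURRENT under the scaling flow, is (i) antitone along the
flow, (ii) lower semicontinuous along recurrence sequences, and (iii) rigid: constancy of
`σ ↦ F(V_σ)` excludes the apex singularity. Then NO member of `𝒟_{C,K}` is singular at the apex.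
Proof: a singular member yields the recurrent critical element `w ∈ 𝒟_{C,K_c}`, `K_c ≤ K`
(ns-lqd-p1), which carries an envelope (`Envelope.envelope_of_minimal`, ns-lqd-p2); all its
translates `w_σ` lie in `𝒮(C,A,K)`; by `lyapunov_constant_fderiv` `F` is constant along the orbit, and
(iii) says `w` is regular — contradiction. -/
theorem not_singular_of_lyapunov {C K : ℝ}
    (hF : ∀ A : ℝ, ∃ F : (ℝ → EuclideanSpace ℝ (Fin 3) → EuclideanSpace ℝ (Fin 3)) → ℝ,
      -- (i) antitone along the scaling flow on `𝒮(C,A,K)`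
      (∀ V : ℝ → EuclideanSpace ℝ (Fin 3) → EuclideanSpace ℝ (Fin 3),
        IsTypeIAncientMild C V → HasTypeIDecay A V →
        (∀ s : ℝ, s < 0 → ∫⁻ x, ‖fderiv ℝ (V s) x‖ₑ ^ 2 ≤ ENNReal.ofReal (K / Real.sqrt (-s))) →
        (∀ r > 0, ∀ M : ℝ, ∃ t ∈ Set.Ioo (-(r ^ 2)) (0 : ℝ),
          ∃ x ∈ Metric.ball (0 : EuclideanSpace ℝ (Fin 3)) r, M < ‖V t x‖) →
        (∀ ε > 0, ∀ R > 1, ∃ L > 0, ∀ a : ℝ, ∃ σ ∈ Set.Icc a (a + L),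
          ∀ s ∈ Set.Icc (-(R ^ 2)) (-(R⁻¹) ^ 2),
          ∀ y ∈ Metric.closedBall (0 : EuclideanSpace ℝ (Fin 3)) R,
            ‖Real.exp σ • V (Real.exp (2 * σ) * s) (Real.exp σ • y) - V s y‖ ≤ ε) →
        ∀ σ τ : ℝ, σ ≤ τ → F (nsRescale (Real.exp τ) V) ≤ F (nsRescale (Real.exp σ) V)) ∧
      -- (ii) lower semicontinuous along recurrence sequences on `𝒮(C,A,K)`
      (∀ V : ℝ → EuclideanSpace ℝ (Fin 3) → EuclideanSpace ℝ (Fin 3),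
        IsTypeIAncientMild C V → HasTypeIDecay A V →
        (∀ s : ℝ, s < 0 → ∫⁻ x, ‖fderiv ℝ (V s) x‖ₑ ^ 2 ≤ ENNReal.ofReal (K / Real.sqrt (-s))) →
        (∀ r > 0, ∀ M : ℝ, ∃ t ∈ Set.Ioo (-(r ^ 2)) (0 : ℝ),
          ∃ x ∈ Metric.ball (0 : EuclideanSpace ℝ (Fin 3)) r, M < ‖V t x‖) →
        (∀ ε > 0, ∀ R > 1, ∃ L > 0, ∀ a : ℝ, ∃ σ ∈ Set.Icc a (a + L),
          ∀ s ∈ Set.Icc (-(R ^ 2)) (-(R⁻¹) ^ 2),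
          ∀ y ∈ Metric.closedBall (0 : EuclideanSpace ℝ (Fin 3)) R,
            ‖Real.exp σ • V (Real.exp (2 * σ) * s) (Real.exp σ • y) - V s y‖ ≤ ε) →
        ∀ l : ℕ → ℝ, Tendsto l atTop atTop →
          (∀ ε > 0, ∀ R > 1, ∀ᶠ n in atTop,
            ∀ s ∈ Set.Icc (-(R ^ 2)) (-(R⁻¹) ^ 2),
            ∀ y ∈ Metric.closedBall (0 : EuclideanSpace ℝ (Fin 3)) R,
              ‖Real.exp (l n) • V (Real.exp (2 * l n) * s) (Real.exp (l n) • y) - V s y‖ ≤ ε) →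
          (∀ t < 0, ∀ x, Tendsto (fun n => fderiv ℝ (nsRescale (Real.exp (l n)) V t) x) atTop
            (𝓝 (fderiv ℝ (V t) x))) →
          ∀ δ > 0, ∀ᶠ n in atTop, F V - δ ≤ F (nsRescale (Real.exp (l n)) V)) ∧
      -- (iii) rigid: constancy along the orbit excludes the apex singularity
      (∀ V : ℝ → EuclideanSpace ℝ (Fin 3) → EuclideanSpace ℝ (Fin 3),
        IsTypeIAncientMild C V → HasTypeIDecay A V →
        (∀ s : ℝ, s < 0 → ∫⁻ x, ‖fderiv ℝ (V s) x‖ₑ ^ 2 ≤ ENNReal.ofReal (K / Real.sqrt (-s))) →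
        (∀ ε > 0, ∀ R > 1, ∃ L > 0, ∀ a : ℝ, ∃ σ ∈ Set.Icc a (a + L),
          ∀ s ∈ Set.Icc (-(R ^ 2)) (-(R⁻¹) ^ 2),
          ∀ y ∈ Metric.closedBall (0 : EuclideanSpace ℝ (Fin 3)) R,
            ‖Real.exp σ • V (Real.exp (2 * σ) * s) (Real.exp σ • y) - V s y‖ ≤ ε) →
        (∀ σ : ℝ, F (nsRescale (Real.exp σ) V) = F V) →
        ¬ (∀ r > 0, ∀ M : ℝ, ∃ t ∈ Set.Ioo (-(r ^ 2)) (0 : ℝ),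
          ∃ x ∈ Metric.ball (0 : EuclideanSpace ℝ (Fin 3)) r, M < ‖V t x‖)))
    (ū : ℝ → EuclideanSpace ℝ (Fin 3) → EuclideanSpace ℝ (Fin 3)) (hū : IsTypeIAncientMild C ū)
    (hD : ∀ s : ℝ, s < 0 → ∫⁻ x, ‖fderiv ℝ (ū s) x‖ₑ ^ 2 ≤ ENNReal.ofReal (K / Real.sqrt (-s))) :
    ¬ (∀ r > 0, ∀ M : ℝ, ∃ t ∈ Set.Ioo (-(r ^ 2)) (0 : ℝ),
        ∃ x ∈ Metric.ball (0 : EuclideanSpace ℝ (Fin 3)) r, M < ‖ū t x‖) := by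
  intro hsing
  -- the recurrent critical element and its envelope
  obtain ⟨K₁, -, hce⟩ := CriticalElement.exists_recurrent_criticalElement
  obtain ⟨Kc, w, -, hKcK, hw, hDw, hsw, hrec, hmin, -⟩ := hce C K ū hū hD hsing
  obtain ⟨A, -, hA⟩ := Envelope.envelope_of_minimal hmin
  have hdec : HasTypeIDecay A w := hA w hw hDw hsw
  have hDwK : ∀ s : ℝ, s < 0 → ∫⁻ x, ‖fderiv ℝ (w s) x‖ₑ ^ 2 ≤ ENNReal.ofReal (K / Real.sqrt (-s)) :=
    CriticalElement.law_mono hKcK hDw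
  obtain ⟨F, hmono, hlsc, hrig⟩ := hF A
  -- the class `𝒮(C,A,K)` as one predicate, scale invariant
  let P : (ℝ → EuclideanSpace ℝ (Fin 3) → EuclideanSpace ℝ (Fin 3)) → Prop := fun V =>
    IsTypeIAncientMild C V ∧ HasTypeIDecay A V ∧
    (∀ s : ℝ, s < 0 → ∫⁻ x, ‖fderiv ℝ (V s) x‖ₑ ^ 2 ≤ ENNReal.ofReal (K / Real.sqrt (-s))) ∧
    (∀ r > 0, ∀ M : ℝ, ∃ t ∈ Set.Ioo (-(r ^ 2)) (0 : ℝ),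
      ∃ x ∈ Metric.ball (0 : EuclideanSpace ℝ (Fin 3)) r, M < ‖V t x‖) ∧
    (∀ ε > 0, ∀ R > 1, ∃ L > 0, ∀ a : ℝ, ∃ σ ∈ Set.Icc a (a + L),
      ∀ s ∈ Set.Icc (-(R ^ 2)) (-(R⁻¹) ^ 2),
      ∀ y ∈ Metric.closedBall (0 : EuclideanSpace ℝ (Fin 3)) R,
        ‖Real.exp σ • V (Real.exp (2 * σ) * s) (Real.exp σ • y) - V s y‖ ≤ ε)
  have hP : ∀ V, P V → ∀ c : ℝ, 0 < c → P (nsRescale c V) := by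
    rintro V ⟨h1, h2, h3, h4, h5⟩ c hc
    exact ⟨h1.nsRescale hc, h2.nsRescale hc, Negative.dissLaw_nsRescale hc h3,
      Negative.singularAtApex_nsRescale hc h4, recurrent_nsRescale h5 hc⟩
  have hwP : P w := ⟨hw, hdec, hDwK, hsw, hrec⟩
  have hconst := lyapunov_constant_fderiv P (fun V hV => hV.1) hP (fun V hV => hV.2.2.2.2) F
    (fun V hV => hmono V hV.1 hV.2.1 hV.2.2.1 hV.2.2.2.1 hV.2.2.2.2)
    (fun V hV => hlsc V hV.1 hV.2.1 hV.2.2.1 hV.2.2.2.1 hV.2.2.2.2) hwP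
  exact hrig w hw hdec hDwK hrec hconst hsw

/-- **FDL FROM A LYAPUNOV FUNCTIONAL (by name).** If every class `𝒮(C,A,K)` — Type-I ancient mild
with constant `C`, envelope `A`, dissipation law `K`, singular at the apex, uniformly recurrent —
admits a real functional that is antitone along the scaling flow, lower semicontinuous along
recurrence sequences and rigid (constancy along the orbit excludes the singularity), then the crux
`FiniteDissipationLiouville` holds. No such functional is known (Pineau–Vicol 2026 p. 8; census of
leads g0–g7); Navier–Stokes regularity is NOT proved by this. -/
theorem fdl_of_lyapunov
    (hF : ∀ C A K : ℝ, ∃ F : (ℝ → EuclideanSpace ℝ (Fin 3) → EuclideanSpace ℝ (Fin 3)) → ℝ,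
      (∀ V : ℝ → EuclideanSpace ℝ (Fin 3) → EuclideanSpace ℝ (Fin 3),
        IsTypeIAncientMild C V → HasTypeIDecay A V →
        (∀ s : ℝ, s < 0 → ∫⁻ x, ‖fderiv ℝ (V s) x‖ₑ ^ 2 ≤ ENNReal.ofReal (K / Real.sqrt (-s))) →
        (∀ r > 0, ∀ M : ℝ, ∃ t ∈ Set.Ioo (-(r ^ 2)) (0 : ℝ),
          ∃ x ∈ Metric.ball (0 : EuclideanSpace ℝ (Fin 3)) r, M < ‖V t x‖) →
        (∀ ε > 0, ∀ R > 1, ∃ L > 0, ∀ a : ℝ, ∃ σ ∈ Set.Icc a (a + L),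
          ∀ s ∈ Set.Icc (-(R ^ 2)) (-(R⁻¹) ^ 2),
          ∀ y ∈ Metric.closedBall (0 : EuclideanSpace ℝ (Fin 3)) R,
            ‖Real.exp σ • V (Real.exp (2 * σ) * s) (Real.exp σ • y) - V s y‖ ≤ ε) →
        ∀ σ τ : ℝ, σ ≤ τ → F (nsRescale (Real.exp τ) V) ≤ F (nsRescale (Real.exp σ) V)) ∧
      (∀ V : ℝ → EuclideanSpace ℝ (Fin 3) → EuclideanSpace ℝ (Fin 3),
        IsTypeIAncientMild C V → HasTypeIDecay A V →
        (∀ s : ℝ, s < 0 → ∫⁻ x, ‖fderiv ℝ (V s) x‖ₑ ^ 2 ≤ ENNReal.ofReal (K / Real.sqrt (-s))) →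
        (∀ r > 0, ∀ M : ℝ, ∃ t ∈ Set.Ioo (-(r ^ 2)) (0 : ℝ),
          ∃ x ∈ Metric.ball (0 : EuclideanSpace ℝ (Fin 3)) r, M < ‖V t x‖) →
        (∀ ε > 0, ∀ R > 1, ∃ L > 0, ∀ a : ℝ, ∃ σ ∈ Set.Icc a (a + L),
          ∀ s ∈ Set.Icc (-(R ^ 2)) (-(R⁻¹) ^ 2),
          ∀ y ∈ Metric.closedBall (0 : EuclideanSpace ℝ (Fin 3)) R,
            ‖Real.exp σ • V (Real.exp (2 * σ) * s) (Real.exp σ • y) - V s y‖ ≤ ε) →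
        ∀ l : ℕ → ℝ, Tendsto l atTop atTop →
          (∀ ε > 0, ∀ R > 1, ∀ᶠ n in atTop,
            ∀ s ∈ Set.Icc (-(R ^ 2)) (-(R⁻¹) ^ 2),
            ∀ y ∈ Metric.closedBall (0 : EuclideanSpace ℝ (Fin 3)) R,
              ‖Real.exp (l n) • V (Real.exp (2 * l n) * s) (Real.exp (l n) • y) - V s y‖ ≤ ε) →
          (∀ t < 0, ∀ x, Tendsto (fun n => fderiv ℝ (nsRescale (Real.exp (l n)) V t) x) atTop
            (𝓝 (fderiv ℝ (V t) x))) →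
          ∀ δ > 0, ∀ᶠ n in atTop, F V - δ ≤ F (nsRescale (Real.exp (l n)) V)) ∧
      (∀ V : ℝ → EuclideanSpace ℝ (Fin 3) → EuclideanSpace ℝ (Fin 3),
        IsTypeIAncientMild C V → HasTypeIDecay A V →
        (∀ s : ℝ, s < 0 → ∫⁻ x, ‖fderiv ℝ (V s) x‖ₑ ^ 2 ≤ ENNReal.ofReal (K / Real.sqrt (-s))) →
        (∀ ε > 0, ∀ R > 1, ∃ L > 0, ∀ a : ℝ, ∃ σ ∈ Set.Icc a (a + L),
          ∀ s ∈ Set.Icc (-(R ^ 2)) (-(R⁻¹) ^ 2),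
          ∀ y ∈ Metric.closedBall (0 : EuclideanSpace ℝ (Fin 3)) R,
            ‖Real.exp σ • V (Real.exp (2 * σ) * s) (Real.exp σ • y) - V s y‖ ≤ ε) →
        (∀ σ : ℝ, F (nsRescale (Real.exp σ) V) = F V) →
        ¬ (∀ r > 0, ∀ M : ℝ, ∃ t ∈ Set.Ioo (-(r ^ 2)) (0 : ℝ),
          ∃ x ∈ Metric.ball (0 : EuclideanSpace ℝ (Fin 3)) r, M < ‖V t x‖))) :
    Theses.LerayQuarterDissipation.FiniteDissipationLiouville := by
  intro C K ū hū hD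
  exact not_singular_of_lyapunov (fun A => hF C A K) ū hū hD

/-- **The crux IS the existence of Lyapunov functionals** (bookkeeping converse: under FDL every
class `𝒮(C,A,K)` is empty, so `F = 0` qualifies vacuously). -/
theorem fdl_iff_exists_lyapunov :
    Theses.LerayQuarterDissipation.FiniteDissipationLiouville ↔
    (∀ C A K : ℝ, ∃ F : (ℝ → EuclideanSpace ℝ (Fin 3) → EuclideanSpace ℝ (Fin 3)) → ℝ,
      (∀ V : ℝ → EuclideanSpace ℝ (Fin 3) → EuclideanSpace ℝ (Fin 3),
        IsTypeIAncientMild C V → HasTypeIDecay A V →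
        (∀ s : ℝ, s < 0 → ∫⁻ x, ‖fderiv ℝ (V s) x‖ₑ ^ 2 ≤ ENNReal.ofReal (K / Real.sqrt (-s))) →
        (∀ r > 0, ∀ M : ℝ, ∃ t ∈ Set.Ioo (-(r ^ 2)) (0 : ℝ),
          ∃ x ∈ Metric.ball (0 : EuclideanSpace ℝ (Fin 3)) r, M < ‖V t x‖) →
        (∀ ε > 0, ∀ R > 1, ∃ L > 0, ∀ a : ℝ, ∃ σ ∈ Set.Icc a (a + L),
          ∀ s ∈ Set.Icc (-(R ^ 2)) (-(R⁻¹) ^ 2),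
          ∀ y ∈ Metric.closedBall (0 : EuclideanSpace ℝ (Fin 3)) R,
            ‖Real.exp σ • V (Real.exp (2 * σ) * s) (Real.exp σ • y) - V s y‖ ≤ ε) →
        ∀ σ τ : ℝ, σ ≤ τ → F (nsRescale (Real.exp τ) V) ≤ F (nsRescale (Real.exp σ) V)) ∧
      (∀ V : ℝ → EuclideanSpace ℝ (Fin 3) → EuclideanSpace ℝ (Fin 3),
        IsTypeIAncientMild C V → HasTypeIDecay A V →
        (∀ s : ℝ, s < 0 → ∫⁻ x, ‖fderiv ℝ (V s) x‖ₑ ^ 2 ≤ ENNReal.ofReal (K / Real.sqrt (-s))) →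
        (∀ r > 0, ∀ M : ℝ, ∃ t ∈ Set.Ioo (-(r ^ 2)) (0 : ℝ),
          ∃ x ∈ Metric.ball (0 : EuclideanSpace ℝ (Fin 3)) r, M < ‖V t x‖) →
        (∀ ε > 0, ∀ R > 1, ∃ L > 0, ∀ a : ℝ, ∃ σ ∈ Set.Icc a (a + L),
          ∀ s ∈ Set.Icc (-(R ^ 2)) (-(R⁻¹) ^ 2),
          ∀ y ∈ Metric.closedBall (0 : EuclideanSpace ℝ (Fin 3)) R,
            ‖Real.exp σ • V (Real.exp (2 * σ) * s) (Real.exp σ • y) - V s y‖ ≤ ε) →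
        ∀ l : ℕ → ℝ, Tendsto l atTop atTop →
          (∀ ε > 0, ∀ R > 1, ∀ᶠ n in atTop,
            ∀ s ∈ Set.Icc (-(R ^ 2)) (-(R⁻¹) ^ 2),
            ∀ y ∈ Metric.closedBall (0 : EuclideanSpace ℝ (Fin 3)) R,
              ‖Real.exp (l n) • V (Real.exp (2 * l n) * s) (Real.exp (l n) • y) - V s y‖ ≤ ε) →
          (∀ t < 0, ∀ x, Tendsto (fun n => fderiv ℝ (nsRescale (Real.exp (l n)) V t) x) atTop
            (𝓝 (fderiv ℝ (V t) x))) →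
          ∀ δ > 0, ∀ᶠ n in atTop, F V - δ ≤ F (nsRescale (Real.exp (l n)) V)) ∧
      (∀ V : ℝ → EuclideanSpace ℝ (Fin 3) → EuclideanSpace ℝ (Fin 3),
        IsTypeIAncientMild C V → HasTypeIDecay A V →
        (∀ s : ℝ, s < 0 → ∫⁻ x, ‖fderiv ℝ (V s) x‖ₑ ^ 2 ≤ ENNReal.ofReal (K / Real.sqrt (-s))) →
        (∀ ε > 0, ∀ R > 1, ∃ L > 0, ∀ a : ℝ, ∃ σ ∈ Set.Icc a (a + L),
          ∀ s ∈ Set.Icc (-(R ^ 2)) (-(R⁻¹) ^ 2),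
          ∀ y ∈ Metric.closedBall (0 : EuclideanSpace ℝ (Fin 3)) R,
            ‖Real.exp σ • V (Real.exp (2 * σ) * s) (Real.exp σ • y) - V s y‖ ≤ ε) →
        (∀ σ : ℝ, F (nsRescale (Real.exp σ) V) = F V) →
        ¬ (∀ r > 0, ∀ M : ℝ, ∃ t ∈ Set.Ioo (-(r ^ 2)) (0 : ℝ),
          ∃ x ∈ Metric.ball (0 : EuclideanSpace ℝ (Fin 3)) r, M < ‖V t x‖))) := by
  refine ⟨fun hfdl C A K => ⟨fun _ => 0, ?_, ?_, ?_⟩, fdl_of_lyapunov⟩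
  · intro V _ _ _ _ _ σ τ _
    exact le_rfl
  · intro V hV _ hlaw hsing
    exact absurd hsing (hfdl C K V hV hlaw)
  · intro V hV _ hlaw _ _
    exact hfdl C K V hV hlaw

/-- **The crux is the emptiness of the singular recurrent envelope classes** (bookkeeping, for
outsiders): `FiniteDissipationLiouville` holds iff NO field is simultaneously Type-I ancient mild
(some `C`), enveloped (some `A`), dissipative at Leray's rate (some `K`), singular at the apex and
uniformly recurrent under the scaling flow — i.e. every `𝒮(C,A,K)` is empty. (⇐: the recurrent
critical element of ns-lqd-p1 with the envelope of ns-lqd-p2; ⇒: FDL forbids singular members.) -/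
theorem fdl_iff_recurrentEnvelopeClass_empty :
    Theses.LerayQuarterDissipation.FiniteDissipationLiouville ↔
    ∀ (C A K : ℝ) (V : ℝ → EuclideanSpace ℝ (Fin 3) → EuclideanSpace ℝ (Fin 3)),
      IsTypeIAncientMild C V → HasTypeIDecay A V →
      (∀ s : ℝ, s < 0 → ∫⁻ x, ‖fderiv ℝ (V s) x‖ₑ ^ 2 ≤ ENNReal.ofReal (K / Real.sqrt (-s))) →
      (∀ ε > 0, ∀ R > 1, ∃ L > 0, ∀ a : ℝ, ∃ σ ∈ Set.Icc a (a + L),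
        ∀ s ∈ Set.Icc (-(R ^ 2)) (-(R⁻¹) ^ 2),
        ∀ y ∈ Metric.closedBall (0 : EuclideanSpace ℝ (Fin 3)) R,
          ‖Real.exp σ • V (Real.exp (2 * σ) * s) (Real.exp σ • y) - V s y‖ ≤ ε) →
      ¬ (∀ r > 0, ∀ M : ℝ, ∃ t ∈ Set.Ioo (-(r ^ 2)) (0 : ℝ),
          ∃ x ∈ Metric.ball (0 : EuclideanSpace ℝ (Fin 3)) r, M < ‖V t x‖) := by
  refine ⟨fun hfdl C A K V hV _ hlaw _ => hfdl C K V hV hlaw, fun h C K ū hū hD hsing => ?_⟩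
  obtain ⟨K₁, -, hce⟩ := CriticalElement.exists_recurrent_criticalElement
  obtain ⟨Kc, w, -, -, hw, hDw, hsw, hrec, hmin, -⟩ := hce C K ū hū hD hsing
  obtain ⟨A, -, hA⟩ := Envelope.envelope_of_minimal hmin
  exact h C A Kc w hw (hA w hw hDw hsw) hDw hrec hsw

end Summit.NavierStokesRegularity.NavierStokesRegularity.Theorems.FiniteDissipationLiouville.Lyapunov

end
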